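import Summits.QuantumFields.YangMills.Theorems.BalabanUVNodesN15CovariantLandauOnePropagatorKnitFour
import Summits.QuantumFields.YangMills.Theorems.BalabanUVNodesN15TwoSpacingGluingCurvedKnitCovariantLandauGlobalRowsFromDefect
import HarnessLib

/-!
# N15 = NE2 — dag-n15-a g33, (♭-8b): ★★★★ THE ROAD-(c) LITERAL WITH THE (P-R) PROPAGATOR IN ALL THREE LAYERS, ALL FOUR OPERATOR ENTRIES CONCRETE, MODULO ONLY THE TWO-GRID η-DEFECT ROW
# OF THE LANDAU LETTER `N_V^R` — `Live ∧ N15At` for `sfObjects₈qvr` on n15-c∕234's display; pinned threshold; keyed face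
# (dag-n15-a g33, (♭-8b); node N15 = NE2; `--supports stmt-QuantumFields-27366 --as helper`, count-neutral; 1 plumbing def + theorems; imports (R8b), (♭-8a))

WHY.  After PROGRAMME (P-R)₄ (`hE` dropped, (R8b)) and n15-c∕234 (every one-grid Landau row a theorem), the only displayed hypothesis of the (P-R) operator layer is the two-grid η-defect row
of `N_V^R` (`hD`, n15-c's located g24 object (G3)).  (♭-8a) NAMED 233∕234's reductions; THIS FILE is (R8b)'s §2 text with `hP` deleted and the reduction `landauRows_small_of_defectRow`:
ALL THREE LAYERS of the one-propagator literal — Bałaban's WHOLE covariant summand live in the ONE propagator of (3.42), (3.48), (3.187) — modulo `hD` ALONE.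

WHAT.  ★★★★ `exists_live_and_n15At_sfObjects₈qvr_of_defectRow … μ₁ μ₂ (hD) … : ∃ w, Live ∧ N15At`; def `wQ8D`; ★★★★ `live_and_n15At_sfObjects₈qvr_wQ8D`; keyed face `s_N15_of_admits_sf₈qvr_defect`.
`hD` = n15-c∕234 `ne2PlusOperator_sfqr_of_defectRow`'s hypothesis LITERALLY.

HONEST FRAMING ∕ LIMITS.  ONE displayed hypothesis remains: the two-grid η-defect row of `N_V^R` (HYPOTHESIS).  Behind (♭-8a): King's `A = 0` MODEL theorems (n15-c∕220), the T⁴ cell's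
Combes–Thomas theorem (n15-c∕222b), n15-c's Leibniz route (224–232) — MODEL statements read through exact dictionaries.  MODEL carriers ∕ operators (doubled torus `2L^{m+1}`, `L ≥ 7`, global
small-field gauge, one averaging level, unit weights, site transporters, `Q(U)` = main term (125) of [B7] (124), King-block-mean pairing, `Reg336` idle, covariant forward gradients in FILE
144's model sense, crude constants, `Classical.choose` threshold); the η-rate inequalities are quantifier TEMPLATES — NOT [B9] Thms 3.1 ∕ 3.2 ∕ 3.4 ∕ 3.14 ∕ 3.15 AS PRINTED; NE2⁺ NOT PRINTED.
N15 stays DISCHARGED OF RECORD 8∕27 AS CONSUMED (U-blind v7 pin, p687738) — no re-pin asked, nothing re-claimed, no count moved; K3⁸ OPEN; finite 𝕋⁴ per index — NOT ℝ⁴ ∕ OS ∕ mass gap ∕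
Clay.  Plumbing `def` ⇒ review ∕ audit lane.  No `sorry`, `instance`, `notation`; standard axioms.
-/

noncomputable section

open scoped BigOperators Matrix

namespace Summit.QuantumFields.YangMills.BalabanUVNodes.N15.SiteLayerSf

open Literature.MathematicalPhysics.QuantumFieldTheory.Balaban1983to89
open Literature.MathematicalPhysics.QuantumFieldTheory.Balaban1983to89.T4EtaRate (NE2PlusOperator NE2PlusSite NE2PlusUnit rateFactor)
open Literature.MathematicalPhysics.QuantumFieldTheory.Balaban1983to89.B11SectG (BlockNorm HasMaj)
open Literature.MathematicalPhysics.QuantumFieldTheory.Balaban1983to89.B5Prop11Plancherel (Tor fine)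
open Literature.MathematicalPhysics.QuantumFieldTheory.Balaban1983to89.B6UnitTorusCarrier (unitTorusGeo)
open Literature.MathematicalPhysics.QuantumFieldTheory.Balaban1983to89.T4EtaRateDefect (idef)
open Literature.MathematicalPhysics.QuantumFieldTheory.Balaban1983to89.T4EtaRateCoeffDefect (pull)
open Literature.MathematicalPhysics.QuantumFieldTheory.King1986.Torus (blockOf)
open Literature.Barriers.QuantumFields (traceForm)
open Summit.QuantumFields.YangMills.BalabanUVNodes.N15.BackgroundLayer (gavgM)
open Summit.QuantumFields.YangMills.BalabanUVNodes.N15.VectorPiece (bshiftEquiv kingPrV tensorId)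
open Summit.QuantumFields.YangMills.BalabanUVNodes.N15.MatrixSpecies (liftBlk liftMap)
open Summit.QuantumFields.YangMills.BalabanUVNodes.N15.TwoGrid (gOp)
open Summit.QuantumFields.YangMills.BalabanUVNodes.N15.Gluing (SfIdx sfGeo sfInstance sfFamily sfqrFamily sfqrEntry0 CvX CvX' cvM cvBlk CvNorm cvNL cvNL' cvGlued cvGlued' cvNVq cvNVq' cvNVr cvNVr'
  ne2PlusOperator_sfqr_of_global_small sfqrE₄ ne2PlusOperator_sfqr₄E landauRows_small_of_gradDiffRow landauRows_small_of_defectRow cvT₀)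
open Summit.QuantumFields.YangMills.BalabanUVNodes.N15.OperatorReadout (opGeo)
open Summit.QuantumFields.YangMills.BalabanUVNodes.N15.CovLandau (cgrad cGreen)
open Literature.MathematicalPhysics.QuantumFieldTheory.King1986 (aK)
open Summit.QuantumFields.YangMills.BalabanUVNodes.N15.PairedFamilyGuard (Live)
open Literature.MathematicalPhysics.QuantumFieldTheory.Balaban1983to89.T4Continuum (T4Family ULoop)
open Node00 (NE2Objects₁₁)
open Summit.QuantumFields.YangMills.BalabanUVNodes.N15.AtKeyedHome (s_N15_of_admits)
open YMDAG.UVSplit (Datum RateCarriers RateRecordPred N15At S_N15 ne2OfRecord₁₁)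

variable (d : ℕ) {L : ℕ} [NeZero L] (mm ι : Type) [Fintype mm] [DecidableEq mm] [Fintype ι] [DecidableEq ι] (a : ℝ) (e : Matrix mm mm ℂ ≃L[ℝ] (ι → ℝ))

open scoped Matrix.Norms.L2Operator

/-! ## All three layers, all four operator entries concrete, modulo the two-grid defect row of `N_V^R` alone -/

section Closed

variable [Nonempty mm]

/-- ★★★ **GUARD ∧ `N15At` AT THE (P-R) ONE-PROPAGATOR LITERAL, SOME THRESHOLD, ALL FOUR OPERATOR ENTRIES CONCRETE, ON n15-c∕234's DISPLAY — EVERY ONE-GRID LANDAU ROW A THEOREM** (`hD` = the two-grid defect row of `N_V^R`, the ONE remaining hypothesis; via (♭-8a)) (`d ≥ 1`, odd `L ≥ 7`,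
`a, c₃₅ > 0`, trace-form coordinates `e`, `ι`, `mm` nonempty): OPERATOR = (R8a) `ne2PlusOperator_sfqr₄E` (ALL FOUR ENTRIES of (3.42) constructed; `hD` displayed as in 234), SITE = §2 `ne2PlusSite_foSiteAny_sfqr_small` (`hG`),
UNIT = §2 `ne2PlusUnit_foCovAnyLam_sfqr_small` (`hG`), GUARD = (Ð-5) `live_sfGELam` — ONE propagator `X_r` in (3.42), (3.48) and (3.187), ONE displayed Landau family feeding all three layers.
[cite: Balaban1985BackgroundPropagators, Thm 3.1 (3.42) p.397, Thm 3.2 (3.47)–(3.48) p.398, Thm 3.15 (3.187) p.432 (templates: MODEL level), (3.25)–(3.26) p.395, (3.49) p.398; Balaban1985Averaging, (124)–(125) p.36] -/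
theorem exists_live_and_n15At_sfObjects₈qvr_of_defectRow [Nonempty ι] (hd : 1 ≤ d) (hL : Odd L ∧ 1 < L) (hL7 : 7 ≤ L) (ha : 0 < a) {c35 : ℝ} (hc35 : 0 < c35)
    (he : ∀ A B : Matrix mm mm ℂ, traceForm A B = e A ⬝ᵥ e B) (μ₁ μ₂ : Fin (d + 1))
    (hD : ∃ δD CR γR aD : ℝ, 0 < δD ∧ 0 ≤ CR ∧ 0 < γR ∧ 0 < aD ∧
      ∀ i : SfIdx d L, ∀ α₀ : ℝ, 0 < α₀ → (L : ℝ) ^ i.m * α₀ ≤ aD → ∀ A' : Fin (d + 1) → CvX' d L i.m i.kk i.r hL → Matrix mm mm ℂ, (sfInstance d mm ι hL i).Bf.Reg335 c35 α₀ A' →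
        HasMaj (CvNorm d L i.m i.kk hL ι) (BlockNorm.ofBlocks (unitTorusGeo L i.kk (cvM d L i.m i.kk hL)) (liftBlk (cvBlk d L i.m i.kk hL ∘ (kingPrV L i.kk i.r (cvM d L i.m i.kk hL))) ι)) (idef (pull (liftMap (kingPrV L i.kk i.r (cvM d L i.m i.kk hL)) ι)) (pull (liftMap (kingPrV L i.kk i.r (cvM d L i.m i.kk hL)) ι)) (cvNVr' d L i.m i.kk i.r hL a ι e (fun μ x' => NormedSpace.exp (((((L ^ i.r * L ^ i.kk : ℕ) : ℝ))⁻¹) • A' μ x'))) (cvNVr d L i.m i.kk hL a ι e (fun μ x => NormedSpace.exp (((((L ^ i.kk : ℕ) : ℝ))⁻¹) • gavgM (Matrix mm mm ℂ) (Fin (d + 1)) (kingPrV L i.kk i.r (cvM d L i.m i.kk hL)) A' μ x)))) (fun y y' => (CR * ((L : ℝ) ^ i.kk) ^ (-γR)) * Real.exp (-(δD * (unitTorusGeo L i.kk (cvM d L i.m i.kk hL)).dist y y'))))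
    (α β : Fin (d + 1)) (j j' : ι) (α' β' : Fin (d + 1)) (j₂ j₂' : ι) (p : ℝ) :
    ∃ w : ℝ, Live (ne2OfRecord₁₁ (sfObjects₈qvr d mm ι a e hL μ₁ μ₂ α β j j' α' β' j₂ j₂' c35 p w)) ∧
      N15At (ne2OfRecord₁₁ (sfObjects₈qvr d mm ι a e hL μ₁ μ₂ α β j j' α' β' j₂ j₂' c35 p w)) :=
  exists_live_and_n15At_sfObjects₈qvr d mm ι a e hd hL hL7 ha hc35 he μ₁ μ₂ (landauRows_small_of_defectRow d mm ι e hL hL7 ha hc35 hD) α β j j' α' β' j₂ j₂' p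

/-- **THE PINNED THRESHOLD** `w_Q8` of the (P-R) four-entries literal on n15-c∕234's display (a `Classical.choose`; the cube floor is NOT explicit). [bookkeeping] -/
def wQ8D [Nonempty ι] (hd : 1 ≤ d) (hL : Odd L ∧ 1 < L) (hL7 : 7 ≤ L) (ha : 0 < a) {c35 : ℝ} (hc35 : 0 < c35) (he : ∀ A B : Matrix mm mm ℂ, traceForm A B = e A ⬝ᵥ e B)
    (μ₁ μ₂ : Fin (d + 1))
    (hD : ∃ δD CR γR aD : ℝ, 0 < δD ∧ 0 ≤ CR ∧ 0 < γR ∧ 0 < aD ∧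
      ∀ i : SfIdx d L, ∀ α₀ : ℝ, 0 < α₀ → (L : ℝ) ^ i.m * α₀ ≤ aD → ∀ A' : Fin (d + 1) → CvX' d L i.m i.kk i.r hL → Matrix mm mm ℂ, (sfInstance d mm ι hL i).Bf.Reg335 c35 α₀ A' →
        HasMaj (CvNorm d L i.m i.kk hL ι) (BlockNorm.ofBlocks (unitTorusGeo L i.kk (cvM d L i.m i.kk hL)) (liftBlk (cvBlk d L i.m i.kk hL ∘ (kingPrV L i.kk i.r (cvM d L i.m i.kk hL))) ι)) (idef (pull (liftMap (kingPrV L i.kk i.r (cvM d L i.m i.kk hL)) ι)) (pull (liftMap (kingPrV L i.kk i.r (cvM d L i.m i.kk hL)) ι)) (cvNVr' d L i.m i.kk i.r hL a ι e (fun μ x' => NormedSpace.exp (((((L ^ i.r * L ^ i.kk : ℕ) : ℝ))⁻¹) • A' μ x'))) (cvNVr d L i.m i.kk hL a ι e (fun μ x => NormedSpace.exp (((((L ^ i.kk : ℕ) : ℝ))⁻¹) • gavgM (Matrix mm mm ℂ) (Fin (d + 1)) (kingPrV L i.kk i.r (cvM d L i.m i.kk hL)) A' μ x)))) (fun y y'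 => (CR * ((L : ℝ) ^ i.kk) ^ (-γR)) * Real.exp (-(δD * (unitTorusGeo L i.kk (cvM d L i.m i.kk hL)).dist y y'))))
    (α β : Fin (d + 1)) (j j' : ι) (α' β' : Fin (d + 1)) (j₂ j₂' : ι) (p : ℝ) : ℝ :=
  Classical.choose (exists_live_and_n15At_sfObjects₈qvr_of_defectRow d mm ι a e hd hL hL7 ha hc35 he μ₁ μ₂ hD α β j j' α' β' j₂ j₂' p)

/-- ★★★ **GUARD ∧ `N15At` AT THE (P-R) ONE-PROPAGATOR LITERAL PINNED AT `w_Q8`** (234's display: all four operator entries concrete, every one-grid Landau row a theorem) — the lane's most print-faithful `Live ∧ N15At`: ONE model propagator `G(U) = X_r` with Bałaban's WHOLE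
covariant summand `a·Q*(U)Q(U) − D_U(I − R(U))D*_U` live, read by (3.42), (3.48) and (3.187) alike, covariant averaging in the sandwich, genuine Dirichlet region — all four operator entries CONCRETE, MODULO ONLY
the two-grid defect row `hD` of `N_V^R`; MODEL carriers. [cite: Balaban1985BackgroundPropagators, (3.42) p.397, Thms 3.1∕3.2 p.398, Thm 3.15 p.432, (3.25)–(3.26) p.395 (shape)] -/
theorem live_and_n15At_sfObjects₈qvr_wQ8D [Nonempty ι] (hd : 1 ≤ d) (hL : Odd L ∧ 1 < L) (hL7 : 7 ≤ L) (ha : 0 < a) {c35 : ℝ} (hc35 : 0 < c35)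
    (he : ∀ A B : Matrix mm mm ℂ, traceForm A B = e A ⬝ᵥ e B) (μ₁ μ₂ : Fin (d + 1))
    (hD : ∃ δD CR γR aD : ℝ, 0 < δD ∧ 0 ≤ CR ∧ 0 < γR ∧ 0 < aD ∧
      ∀ i : SfIdx d L, ∀ α₀ : ℝ, 0 < α₀ → (L : ℝ) ^ i.m * α₀ ≤ aD → ∀ A' : Fin (d + 1) → CvX' d L i.m i.kk i.r hL → Matrix mm mm ℂ, (sfInstance d mm ι hL i).Bf.Reg335 c35 α₀ A' →
        HasMaj (CvNorm d L i.m i.kk hL ι) (BlockNorm.ofBlocks (unitTorusGeo L i.kk (cvM d L i.m i.kk hL)) (liftBlk (cvBlk d L i.m i.kk hL ∘ (kingPrV L i.kk i.r (cvM d L i.m i.kk hL))) ι)) (idef (pull (liftMap (kingPrV L i.kk i.r (cvM d L i.m i.kk hL)) ι)) (pull (liftMap (kingPrV L i.kk i.r (cvM d L i.m i.kk hL)) ι)) (cvNVr' d L i.m i.kk i.r hL a ι e (fun μ x' => NormedSpace.exp (((((L ^ i.r * L ^ i.kk : ℕ) : ℝ))⁻¹) • A' μ x'))) (cvNVr d L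 i.m i.kk hL a ι e (fun μ x => NormedSpace.exp (((((L ^ i.kk : ℕ) : ℝ))⁻¹) • gavgM (Matrix mm mm ℂ) (Fin (d + 1)) (kingPrV L i.kk i.r (cvM d L i.m i.kk hL)) A' μ x)))) (fun y y' => (CR * ((L : ℝ) ^ i.kk) ^ (-γR)) * Real.exp (-(δD * (unitTorusGeo L i.kk (cvM d L i.m i.kk hL)).dist y y'))))
    (α β : Fin (d + 1)) (j j' : ι) (α' β' : Fin (d + 1)) (j₂ j₂' : ι) (p : ℝ) :
    Live (ne2OfRecord₁₁ (sfObjects₈qvr d mm ι a e hL μ₁ μ₂ α β j j' α' β' j₂ j₂' c35 p (wQ8D d mm ι a e hd hL hL7 ha hc35 he μ₁ μ₂ hD α β j j' α' β' j₂ j₂' p))) ∧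
      N15At (ne2OfRecord₁₁ (sfObjects₈qvr d mm ι a e hL μ₁ μ₂ α β j j' α' β' j₂ j₂' c35 p (wQ8D d mm ι a e hd hL hL7 ha hc35 he μ₁ μ₂ hD α β j j' α' β' j₂ j₂' p))) :=
  Classical.choose_spec (exists_live_and_n15At_sfObjects₈qvr_of_defectRow d mm ι a e hd hL hL7 ha hc35 he μ₁ μ₂ hD α β j j' α' β' j₂ j₂' p)

variable {N : ℕ} [NeZero N] {key : (F : T4Family) → Datum F N → Prop}

/-- ★★ **THE (P-R) FOUR-ENTRIES LITERAL AT ANY KEYED HOME** (part 30's interface; `ne2At` a BINDER, `hadm` AND the value equation `h` hypotheses — no pin, no v8): a rate home over ANY key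
admitting only the literals of a key-indexed NE2 reading whose value everywhere is the pinned (P-R) one-propagator literal has `S_N15 RRec` — modulo `hD` ONLY. [bookkeeping] -/
theorem s_N15_of_admits_sf₈qvr_defect [Nonempty ι] (hd : 1 ≤ d) (hL : Odd L ∧ 1 < L) (hL7 : 7 ≤ L) (ha : 0 < a) {c35 : ℝ} (hc35 : 0 < c35)
    (he : ∀ A B : Matrix mm mm ℂ, traceForm A B = e A ⬝ᵥ e B) (μ₁ μ₂ : Fin (d + 1))
    (hD : ∃ δD CR γR aD : ℝ, 0 < δD ∧ 0 ≤ CR ∧ 0 < γR ∧ 0 < aD ∧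
      ∀ i : SfIdx d L, ∀ α₀ : ℝ, 0 < α₀ → (L : ℝ) ^ i.m * α₀ ≤ aD → ∀ A' : Fin (d + 1) → CvX' d L i.m i.kk i.r hL → Matrix mm mm ℂ, (sfInstance d mm ι hL i).Bf.Reg335 c35 α₀ A' →
        HasMaj (CvNorm d L i.m i.kk hL ι) (BlockNorm.ofBlocks (unitTorusGeo L i.kk (cvM d L i.m i.kk hL)) (liftBlk (cvBlk d L i.m i.kk hL ∘ (kingPrV L i.kk i.r (cvM d L i.m i.kk hL))) ι)) (idef (pull (liftMap (kingPrV L i.kk i.r (cvM d L i.m i.kk hL)) ι)) (pull (liftMap (kingPrV L i.kk i.r (cvM d L i.m i.kk hL)) ι)) (cvNVr' d L i.m i.kk i.r hL a ι e (fun μ x' => NormedSpace.exp (((((L ^ i.r * L ^ i.kk : ℕ) : ℝ))⁻¹) • A' μ x'))) (cvNVr d L i.m i.kk hL a ι e (fun μ x => NormedSpace.exp (((((L ^ i.kk : ℕ) : ℝ))⁻¹) • gavgM (Matrix mm mm ℂ) (Fin (d + 1)) (kingPrV L i.kk i.r (cvM d L i.m i.kk hL)) A' μ x)))) (fun y y'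 => (CR * ((L : ℝ) ^ i.kk) ^ (-γR)) * Real.exp (-(δD * (unitTorusGeo L i.kk (cvM d L i.m i.kk hL)).dist y y'))))
    (α β : Fin (d + 1)) (j j' : ι) (α' β' : Fin (d + 1)) (j₂ j₂' : ι) (p : ℝ)
    (ne2At : ∀ {F : T4Family} {D : Datum F N}, key F D → (ℕ → ℝ) → List (ULoop F) → ℕ → NE2Objects₁₁) (RRec : RateRecordPred N)
    (hadm : ∀ (F : T4Family) (D : Datum F N) (g₀ : ℕ → ℝ) (os : List (ULoop F)) (R : RateCarriers N), RRec F D g₀ os R →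
      ∃ (h : key F D) (k : ℕ), R.ne2 = ne2OfRecord₁₁ (ne2At h g₀ os k))
    (h : ∀ (F : T4Family) (D : Datum F N) (h : key F D) (g₀ : ℕ → ℝ) (os : List (ULoop F)) (k : ℕ),
      ne2At h g₀ os k = sfObjects₈qvr d mm ι a e hL μ₁ μ₂ α β j j' α' β' j₂ j₂' c35 p (wQ8D d mm ι a e hd hL hL7 ha hc35 he μ₁ μ₂ hD α β j j' α' β' j₂ j₂' p)) :
    S_N15 RRec :=
  s_N15_of_admits ne2At RRec hadm fun F D hk g₀ os k => by
    rw [h F D hk g₀ os k]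
    exact (live_and_n15At_sfObjects₈qvr_wQ8D d mm ι a e hd hL hL7 ha hc35 he μ₁ μ₂ hD α β j j' α' β' j₂ j₂' p).2

end Closed

end Summit.QuantumFields.YangMills.BalabanUVNodes.N15.SiteLayerSf

end
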